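import Literature.Dynamics.TransferOperators.HurwitzTrapezoid
import Literature.Analysis.SpecialFunctions.GammaStirlingUniform
import Mathlib.NumberTheory.LSeries.HurwitzZeta
import Mathlib.Analysis.SpecialFunctions.Gamma.Basic
import Mathlib.Analysis.Complex.Convex
import Mathlib.NumberTheory.LSeries.DirichletContinuation
import HarnessLib

/-!
# Lerch's formula `ζ'(0, x) = log Γ(x) − ½ log(2π)`

Topic `Literature/NumberTheory/LFunctions`. THEOREMS (everything proved; no definitions, no named
facts).

For `0 < x ≤ 1` the derivative at `s = 0` of Mathlib's Hurwitz zeta function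
`s ↦ ζ(s, x) = HurwitzZeta.hurwitzZeta x s` is

  `ζ'(0, x) = log Γ(x) − ½ log(2π)`        (`hasDerivAt_hurwitzZeta_zero`, `deriv_hurwitzZeta_zero`),

in particular `ζ'(0) = −½ log(2π)` (`deriv_riemannZeta_zero_ofReal`; Mathlib has this special
case as `deriv_riemannZeta_zero`, from the functional equation). This is Lerch's formula (Lerch
1894; Whittaker–Watson §13.21; an elementary proof is in Berndt 1985). Consequently, for Mathlib's
congruence `L`-functions `L(s, Φ) = N^{−s} ∑_j Φ(j) ζ(s, x_j)` and for every non-trivial Dirichlet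
character `χ` mod `N`,

  `L'(0, χ) = −(log N) L(0, χ) + ∑_{a=1}^{N−1} χ(a) log Γ(a/N)`
                                  (`hasDerivAt_LFunction_zero`, `deriv_LFunction_zero_of_ne_one`),

the analytic input of the Chowla–Selberg formula, which is why it is vendored next to the Kronecker
limit formula of `Literature/NumberTheory/QuadraticFields/` (support for the discharge of
`Literature.Analysis.FunctionSpaces.BorweinStraubWanZudilin2012_thm9`).

## Proof

We do NOT follow Whittaker–Watson (Hermite/Binet integral) but the Euler–Maclaurin route
(Berndt's): the tree's second-order Euler–Maclaurin remainder
`R(s, x) = Literature.Dynamics.TransferOperators.hurwitzR s x` (file `HurwitzTrapezoid.lean`,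
absolutely convergent for `Re s > −1`) gives the continuation

  `ζ(s, x) = x^{1−s}/(s−1) + x^{−s}/2 + R(s, x)`     (`Re s > −1`, `s ≠ 1`; `hurwitzZeta_eq_trapezoid`),

proved from the Dirichlet series on `Re s > 1` (`hurwitzR_eq_tsum_sub` there, Mathlib's
`hasSum_hurwitzZeta_of_one_lt_re` here) by the identity theorem on two convex half-strips
avoiding the pole. Differentiating the absolutely and locally uniformly convergent series termwise
at `s = 0` (`Complex.hasSum_deriv_of_summable_norm`), the `n`-th term contributes
`(n+x+1) log(n+x+1) − (n+x) log(n+x) − 1 − ½(log(n+x) + log(n+x+1))`, whose partial sums telescope to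
`(N+x−½) log(N+x) − N − log Γ(N+x) + log Γ(x) − x log x + ½ log x`
(`Γ(x+N) = Γ(x) ∏_{n<N} (x+n)`); Stirling's formula for `log Γ` on the real axis (the tree's
`Literature.Analysis.SpecialFunctions.GammaStirling.abs_log_norm_Gamma_sub_le`) evaluates the
limit as `x − ½ log(2π) + log Γ(x) − x log x + ½ log x`, and the elementary terms contribute
`x log x − x − ½ log x`.

The intermediate statement `hasDerivAt_hurwitzEM_zero` is Lerch's formula for EVERY real `x > 0`,
for the Euler–Maclaurin continuation `x^{1−s}/(s−1) + x^{−s}/2 + R(s, x)` (which for `Re s > 0`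
is the tree's complex-parameter Hurwitz zeta function `hurwitzZetaC s x`,
`hurwitzR_eq_hurwitzZetaC_sub`).

## References

* M. Lerch, Další studie v oboru Malmsténovských řad, Rozpravy České Akad. 3 (1894), no. 28.
* E. T. Whittaker, G. N. Watson, *A Course of Modern Analysis*, 4th ed. (1927), §13.21.
* B. C. Berndt, The gamma function and the Hurwitz zeta-function, Amer. Math. Monthly 92 (1985)
  126–130.
-/

noncomputable section

open Complex Filter Topology Set Metric HurwitzZeta
open scoped Real

open Literature.Dynamics.TransferOperators (hurwitzTrapTerm hurwitzR hurwitzR_def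
  norm_hurwitzTrapTerm_le_uniform summable_nat_add_rpow_neg_two
  differentiableAt_hurwitzTrapTerm_left hurwitzR_eq_tsum_sub)

namespace Literature.NumberTheory.LFunctions

namespace Lerch

/-! ### Holomorphy of `s ↦ R(s, b)` on `Re s > −1`, `s ≠ 1`, and termwise differentiation -/

/-- Bounds on a small ball around `σ₀` reaching down to `Re σ₀ > −1`: if `r ≤ (Re σ₀ + 1)/2` and
`r ≤ ‖σ₀ − 1‖/2` then every `σ ∈ ball σ₀ r` satisfies `(Re σ₀ − 1)/2 ≤ Re σ ≤ Re σ₀ + r`,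
`‖σ‖ ≤ ‖σ₀‖ + r`, `|Im σ| ≤ |Im σ₀| + r` and `σ ≠ 1` (variant of the tree's `ball_bounds`, which
needs `Re σ₀ > 0`). [folklore] -/
theorem ball_bounds' {σ₀ σ : ℂ} {r : ℝ} (hr1 : r ≤ (σ₀.re + 1) / 2) (hr2 : r ≤ ‖σ₀ - 1‖ / 2)
    (hσV : σ ∈ ball σ₀ r) :
    (σ₀.re - 1) / 2 ≤ σ.re ∧ σ.re ≤ σ₀.re + r ∧ ‖σ‖ ≤ ‖σ₀‖ + r ∧ |σ.im| ≤ |σ₀.im| + r ∧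
      σ ≠ 1 := by
  have h : ‖σ - σ₀‖ < r := mem_ball_iff_norm.mp hσV
  have hre := (abs_re_le_norm (σ - σ₀)).trans h.le
  rw [sub_re, abs_le] at hre
  have him := (abs_im_le_norm (σ - σ₀)).trans h.le
  rw [sub_im] at him
  have him' := abs_sub_abs_le_abs_sub σ.im σ₀.im
  have hn := norm_le_norm_add_norm_sub' σ σ₀
  refine ⟨by linarith [hre.1], by linarith [hre.2], by linarith, by linarith, fun h1 => ?_⟩
  rw [h1, norm_sub_rev] at h
  have : 0 ≤ ‖σ₀ - 1‖ := norm_nonneg _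
  linarith

/-- **Local M-test data** for the trapezoid series around any `σ₀` with `Re σ₀ > −1`, `σ₀ ≠ 1`
(`Re b > 0`): a ball on which all brackets are holomorphic and dominated by a summable sequence.
[folklore] -/
theorem exists_ball_summable_bound {b : ℂ} (hb : 0 < b.re) {σ₀ : ℂ} (hσ1 : σ₀ ≠ 1)
    (hσ : -1 < σ₀.re) :
    ∃ r : ℝ, 0 < r ∧ ∃ u : ℕ → ℝ, Summable u ∧
      (∀ n, DifferentiableOn ℂ (fun σ => hurwitzTrapTerm σ b n) (ball σ₀ r)) ∧
      (∀ n, ∀ σ ∈ ball σ₀ r, ‖hurwitzTrapTerm σ b n‖ ≤ u n) := by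
  have hd1 : 0 < ‖σ₀ - 1‖ := norm_pos_iff.mpr (sub_ne_zero.mpr hσ1)
  set r : ℝ := min ((σ₀.re + 1) / 2) (‖σ₀ - 1‖ / 2) with hr
  have hr0 : 0 < r := lt_min (by linarith) (by positivity)
  have hr1 : r ≤ (σ₀.re + 1) / 2 := min_le_left _ _
  have hr2 : r ≤ ‖σ₀ - 1‖ / 2 := min_le_right _ _
  have hs₁ : (-1 : ℝ) < (σ₀.re - 1) / 2 := by linarith
  have hs₂ : (-1 : ℝ) < σ₀.re + r := by linarith
  refine ⟨r, hr0, fun n => (‖σ₀‖ + r) * (‖σ₀‖ + r + 1) * Real.exp (π / 2 * (|σ₀.im| + r)) / 2 *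
      (((n : ℝ) + b.re) ^ (-((σ₀.re - 1) / 2 + 2)) + ((n : ℝ) + b.re) ^ (-((σ₀.re + r) + 2))),
    ?_, ?_, ?_⟩
  · exact ((summable_nat_add_rpow_neg_two hb hs₁).add
      (summable_nat_add_rpow_neg_two hb hs₂)).mul_left _
  · intro n σ hσV
    exact (differentiableAt_hurwitzTrapTerm_left hb n
      (ball_bounds' hr1 hr2 hσV).2.2.2.2).differentiableWithinAt
  · intro n σ hσV
    obtain ⟨h₁, h₂, h₃, h₄, h₅⟩ := ball_bounds' hr1 hr2 hσV
    exact norm_hurwitzTrapTerm_le_uniform h₅ h₁ h₂ (by linarith) h₃ h₄ hb le_rfl n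

/-- **Holomorphy of `σ ↦ R(σ, b)`** at every `σ₀` with `Re σ₀ > −1`, `σ₀ ≠ 1` (`Re b > 0`); the
tree's `differentiableAt_hurwitzR_left` covers `Re σ₀ > 0` only. [folklore] -/
theorem differentiableAt_hurwitzR {b : ℂ} (hb : 0 < b.re) {σ₀ : ℂ} (hσ1 : σ₀ ≠ 1)
    (hσ : -1 < σ₀.re) : DifferentiableAt ℂ (fun σ => hurwitzR σ b) σ₀ := by
  obtain ⟨r, hr0, u, hu, hdiff, hle⟩ := exists_ball_summable_bound hb hσ1 hσ
  have he : (fun σ => hurwitzR σ b) = fun σ => ∑' n, hurwitzTrapTerm σ b n := rfl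
  rw [he]
  exact (Complex.differentiableOn_tsum_of_summable_norm hu hdiff isOpen_ball hle).differentiableAt
    (isOpen_ball.mem_nhds (mem_ball_self hr0))

/-- **Termwise differentiation** of `R(σ, b) = ∑ₙ hurwitzTrapTerm σ b n` in `σ` at any `σ₀` with
`Re σ₀ > −1`, `σ₀ ≠ 1`. [folklore] -/
theorem hasSum_deriv_hurwitzR {b : ℂ} (hb : 0 < b.re) {σ₀ : ℂ} (hσ1 : σ₀ ≠ 1)
    (hσ : -1 < σ₀.re) :
    HasSum (fun n => deriv (fun σ => hurwitzTrapTerm σ b n) σ₀)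
      (deriv (fun σ => hurwitzR σ b) σ₀) := by
  obtain ⟨r, hr0, u, hu, hdiff, hle⟩ := exists_ball_summable_bound hb hσ1 hσ
  have he : (fun σ => hurwitzR σ b) = fun σ => ∑' n, hurwitzTrapTerm σ b n := rfl
  rw [he]
  exact Complex.hasSum_deriv_of_summable_norm hu hdiff isOpen_ball hle (mem_ball_self hr0)

/-! ### The Euler–Maclaurin continuation agrees with Mathlib's `hurwitzZeta` -/

/-- On `Re s > 1`: `ζ(s, x) = x^{1−s}/(s−1) + x^{−s}/2 + R(s, x)` for `0 < x ≤ 1` (both sides are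
the Dirichlet series `∑ₙ (n + x)^{−s}`). [folklore] -/
theorem hurwitzZeta_eq_of_one_lt_re {x : ℝ} (hx0 : 0 < x) (hx1 : x ≤ 1) {s : ℂ}
    (hs : 1 < s.re) :
    hurwitzZeta (x : UnitAddCircle) s =
      (x : ℂ) ^ (1 - s) / (s - 1) + (x : ℂ) ^ (-s) / 2 + hurwitzR s x := by
  have hb : 0 < (x : ℂ).re := by simpa using hx0
  rw [hurwitzR_eq_tsum_sub hs hb,
    ← (hasSum_hurwitzZeta_of_one_lt_re ⟨hx0.le, hx1⟩ hs).tsum_eq]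
  have : ∀ n : ℕ, 1 / ((n : ℂ) + x) ^ s = ((n : ℂ) + x) ^ (-s) := fun n => by
    rw [cpow_neg, one_div]
  simp_rw [this]
  ring

/-- The identity theorem on the convex half-strip `{−1 < Re s, Re s − 1 < ε Im s}` (`ε = ±1`),
which avoids the pole `s = 1` and meets `{Re s > 1}`. [folklore] -/
theorem eqOn_hurwitzZeta_piece {x : ℝ} (hx0 : 0 < x) (hx1 : x ≤ 1) {ε : ℝ}
    (hε : ε = 1 ∨ ε = -1) :
    EqOn (hurwitzZeta (x : UnitAddCircle))
      (fun s => (x : ℂ) ^ (1 - s) / (s - 1) + (x : ℂ) ^ (-s) / 2 + hurwitzR s x)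
      {s : ℂ | -1 < s.re ∧ s.re - 1 < ε * s.im} := by
  set U : Set ℂ := {s : ℂ | -1 < s.re ∧ s.re - 1 < ε * s.im} with hU
  have hb : 0 < (x : ℂ).re := by simpa using hx0
  have hx0' : (x : ℂ) ≠ 0 := ofReal_ne_zero.mpr hx0.ne'
  have h1U : ∀ s ∈ U, s ≠ 1 := by
    rintro s ⟨-, h2⟩ rfl
    simp at h2
  have hUo : IsOpen U := by
    rw [hU, Set.setOf_and]
    exact (isOpen_lt continuous_const Complex.continuous_re).inter
      (isOpen_lt (Complex.continuous_re.sub continuous_const)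
        (continuous_const.mul Complex.continuous_im))
  have hUc : IsPreconnected U := by
    rw [hU, Set.setOf_and]
    refine (Convex.inter (convex_halfSpace_re_gt (-1)) ?_).isPreconnected
    have hset : {s : ℂ | s.re - 1 < ε * s.im} =
        {s : ℂ | (fun s : ℂ => s.re - ε * s.im) s < 1} := by
      ext s
      simp only [mem_setOf_eq]
      constructor <;> intro h <;> linarith
    rw [hset]
    refine convex_halfSpace_lt ⟨fun a c => ?_, fun c a => ?_⟩ 1
    · simp only [add_re, add_im]; ring
    · simp only [Complex.smul_re, Complex.smul_im, smul_eq_mul]; ring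
  -- analyticity of both sides on `U`
  have hζ : AnalyticOnNhd ℂ (hurwitzZeta (x : UnitAddCircle)) U := by
    refine DifferentiableOn.analyticOnNhd (fun s hs => ?_) hUo
    exact (differentiableAt_hurwitzZeta _ (h1U s hs)).differentiableWithinAt
  have hF : AnalyticOnNhd ℂ
      (fun s => (x : ℂ) ^ (1 - s) / (s - 1) + (x : ℂ) ^ (-s) / 2 + hurwitzR s x) U := by
    refine DifferentiableOn.analyticOnNhd (fun s hs => ?_) hUo
    have hs1 := h1U s hs
    refine DifferentiableAt.differentiableWithinAt ?_
    refine ((DifferentiableAt.div ?_ ?_ ?_).add ?_).add (differentiableAt_hurwitzR hb hs1 hs.1)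
    · exact (differentiableAt_id.const_sub 1).const_cpow (Or.inl hx0')
    · exact differentiableAt_id.sub_const 1
    · exact sub_ne_zero.mpr hs1
    · exact (differentiableAt_id.neg.const_cpow (Or.inl hx0')).div_const 2
  -- the anchor `z₀ = 2 + 2εi ∈ U ∩ {Re s > 1}`
  have hz₀U : (2 + 2 * ε * I : ℂ) ∈ U := by
    rcases hε with rfl | rfl
    · refine ⟨?_, ?_⟩ <;> norm_num
    · refine ⟨?_, ?_⟩ <;> norm_num
  have hev : (hurwitzZeta (x : UnitAddCircle)) =ᶠ[𝓝 (2 + 2 * ε * I : ℂ)]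
      (fun s => (x : ℂ) ^ (1 - s) / (s - 1) + (x : ℂ) ^ (-s) / 2 + hurwitzR s x) := by
    have hopen : IsOpen {s : ℂ | 1 < s.re} := isOpen_lt continuous_const Complex.continuous_re
    have hmem : (2 + 2 * ε * I : ℂ) ∈ {s : ℂ | 1 < s.re} := by
      simp only [mem_setOf_eq, add_re, mul_re, I_re, I_im, re_ofNat, im_ofNat, ofReal_re,
        ofReal_im]
      norm_num
    filter_upwards [hopen.mem_nhds hmem] with s hs
    exact hurwitzZeta_eq_of_one_lt_re hx0 hx1 hs
  exact hζ.eqOn_of_preconnected_of_eventuallyEq hF hUc hz₀U hev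

/-- **Second-order Euler–Maclaurin continuation of the Hurwitz zeta function**: for `0 < x ≤ 1`,
`Re s > −1`, `s ≠ 1`,
`ζ(s, x) = x^{1−s}/(s−1) + x^{−s}/2 + ∑ₙ [½((n+x)^{−s} + (n+x+1)^{−s}) − ((n+x+1)^{1−s} − (n+x)^{1−s})/(1−s)]`.
[folklore] -/
theorem hurwitzZeta_eq_trapezoid {x : ℝ} (hx0 : 0 < x) (hx1 : x ≤ 1) {s : ℂ} (hs : -1 < s.re)
    (hs1 : s ≠ 1) :
    hurwitzZeta (x : UnitAddCircle) s =
      (x : ℂ) ^ (1 - s) / (s - 1) + (x : ℂ) ^ (-s) / 2 + hurwitzR s x := by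
  by_cases h1 : 1 < s.re
  · exact hurwitzZeta_eq_of_one_lt_re hx0 hx1 h1
  by_cases h2 : s.re - 1 < s.im
  · exact eqOn_hurwitzZeta_piece hx0 hx1 (Or.inl rfl) ⟨hs, by simpa using h2⟩
  by_cases h3 : s.re - 1 < -s.im
  · exact eqOn_hurwitzZeta_piece hx0 hx1 (Or.inr rfl) ⟨hs, by simpa using h3⟩
  exfalso
  apply hs1
  push Not at h1 h2 h3
  apply Complex.ext
  · simp only [one_re]; linarith
  · simp only [one_im]; linarith

/-- **`ζ(0, x) = ½ − x`** for `0 < x ≤ 1` (every trapezoid bracket vanishes at `s = 0`).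
[folklore] -/
theorem hurwitzZeta_apply_zero_eq {x : ℝ} (hx0 : 0 < x) (hx1 : x ≤ 1) :
    hurwitzZeta (x : UnitAddCircle) 0 = 1 / 2 - x := by
  rw [hurwitzZeta_eq_trapezoid hx0 hx1 (by simp) zero_ne_one]
  have h0 : hurwitzR 0 (x : ℂ) = 0 := by
    rw [hurwitzR_def]
    have : ∀ n : ℕ, hurwitzTrapTerm 0 (x : ℂ) n = 0 := fun n => by
      simp only [hurwitzTrapTerm, neg_zero, cpow_zero, sub_zero, cpow_one, div_one]
      ring
    simp_rw [this, tsum_zero]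
  rw [h0]
  simp only [sub_zero, cpow_one, neg_zero, cpow_zero, zero_sub]
  ring

/-! ### The termwise derivative at `s = 0` -/

/-- Derivative of the `n`-th trapezoid bracket at `σ = 0`:
`(n+b+1) log(n+b+1) − (n+b) log(n+b) − 1 − ½(log(n+b) + log(n+b+1))`. [folklore] -/
theorem hasDerivAt_hurwitzTrapTerm_zero {b : ℂ} (hb : 0 < b.re) (n : ℕ) :
    HasDerivAt (fun σ => hurwitzTrapTerm σ b n)
      (((n : ℂ) + b + 1) * log ((n : ℂ) + b + 1) - ((n : ℂ) + b) * log ((n : ℂ) + b) - 1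
        - (log ((n : ℂ) + b) + log ((n : ℂ) + b + 1)) / 2) 0 := by
  have h0 : (n : ℂ) + b ≠ 0 := fun h => by
    have := congrArg Complex.re h
    simp only [add_re, natCast_re, zero_re] at this
    linarith [n.cast_nonneg (α := ℝ)]
  have h1 : (n : ℂ) + b + 1 ≠ 0 := fun h => by
    have := congrArg Complex.re h
    simp only [add_re, natCast_re, one_re, zero_re] at this
    linarith [n.cast_nonneg (α := ℝ)]
  have hA : HasDerivAt (fun σ : ℂ => ((n : ℂ) + b) ^ (-σ)) (-log ((n : ℂ) + b)) 0 := by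
    have := ((hasDerivAt_id (0 : ℂ)).neg).const_cpow (c := (n : ℂ) + b) (Or.inl h0)
    simpa using this
  have hB : HasDerivAt (fun σ : ℂ => ((n : ℂ) + b + 1) ^ (-σ)) (-log ((n : ℂ) + b + 1)) 0 := by
    have := ((hasDerivAt_id (0 : ℂ)).neg).const_cpow (c := (n : ℂ) + b + 1) (Or.inl h1)
    simpa using this
  have hC : HasDerivAt (fun σ : ℂ => ((n : ℂ) + b + 1) ^ (1 - σ))
      (-(((n : ℂ) + b + 1) * log ((n : ℂ) + b + 1))) 0 := by
    have := ((hasDerivAt_id (0 : ℂ)).const_sub 1).const_cpow (c := (n : ℂ) + b + 1) (Or.inl h1)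
    simpa using this
  have hD : HasDerivAt (fun σ : ℂ => ((n : ℂ) + b) ^ (1 - σ))
      (-(((n : ℂ) + b) * log ((n : ℂ) + b))) 0 := by
    have := ((hasDerivAt_id (0 : ℂ)).const_sub 1).const_cpow (c := (n : ℂ) + b) (Or.inl h0)
    simpa using this
  have hE : HasDerivAt (fun σ : ℂ => 1 - σ) (-1) 0 := by
    simpa using (hasDerivAt_id (0 : ℂ)).const_sub 1
  have hquot := (hC.fun_sub hD).fun_div hE (by norm_num : (1 : ℂ) - 0 ≠ 0)
  have hsum := ((hA.fun_add hB).div_const 2).fun_sub hquot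
  refine hsum.congr_deriv ?_
  simp only [sub_zero, cpow_one]
  ring

/-- The same derivative for a real parameter `x > 0`, as a real number. [folklore] -/
theorem deriv_hurwitzTrapTerm_zero_ofReal {x : ℝ} (hx : 0 < x) (n : ℕ) :
    deriv (fun σ => hurwitzTrapTerm σ x n) 0 =
      ((((n : ℝ) + x + 1) * Real.log ((n : ℝ) + x + 1) - ((n : ℝ) + x) * Real.log ((n : ℝ) + x)
        - 1 - (Real.log ((n : ℝ) + x) + Real.log ((n : ℝ) + x + 1)) / 2 : ℝ) : ℂ) := by
  have hb : 0 < ((x : ℂ)).re := by simpa using hx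
  rw [(hasDerivAt_hurwitzTrapTerm_zero hb n).deriv]
  have e0 : ((n : ℂ) + x) = (((n : ℝ) + x : ℝ) : ℂ) := by push_cast; ring
  have e1 : ((n : ℂ) + x + 1) = (((n : ℝ) + x + 1 : ℝ) : ℂ) := by push_cast; ring
  have hp0 : (0 : ℝ) ≤ (n : ℝ) + x := by positivity
  have hp1 : (0 : ℝ) ≤ (n : ℝ) + x + 1 := by positivity
  rw [e1, e0, ← ofReal_log hp0, ← ofReal_log hp1]
  push_cast
  ring

/-! ### Real-variable bookkeeping: telescoping and Stirling -/

/-- Telescoping of the termwise derivatives. [folklore] -/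
theorem sum_range_termDeriv (x : ℝ) (N : ℕ) :
    ∑ n ∈ Finset.range N, (((n : ℝ) + x + 1) * Real.log ((n : ℝ) + x + 1)
        - ((n : ℝ) + x) * Real.log ((n : ℝ) + x) - 1
        - (Real.log ((n : ℝ) + x) + Real.log ((n : ℝ) + x + 1)) / 2) =
      ((N : ℝ) + x) * Real.log ((N : ℝ) + x) - x * Real.log x - N
        - ∑ n ∈ Finset.range N, Real.log ((n : ℝ) + x)
        - (Real.log ((N : ℝ) + x) - Real.log x) / 2 := by
  induction N with
  | zero => simp
  | succ N ih =>
    rw [Finset.sum_range_succ, ih, Finset.sum_range_succ]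
    push_cast
    rw [show (N : ℝ) + 1 + x = (N : ℝ) + x + 1 by ring]
    ring

/-- `∑_{n<N} log(n + x) = log Γ(x + N) − log Γ(x)` for `x > 0`. [folklore] -/
theorem sum_range_log_eq_log_Gamma {x : ℝ} (hx : 0 < x) (N : ℕ) :
    ∑ n ∈ Finset.range N, Real.log ((n : ℝ) + x) =
      Real.log (Real.Gamma ((N : ℝ) + x)) - Real.log (Real.Gamma x) := by
  induction N with
  | zero => simp
  | succ N ih =>
    rw [Finset.sum_range_succ, ih]
    have hpos : 0 < (N : ℝ) + x := by positivity
    have hG : Real.Gamma ((N : ℝ) + x + 1) = ((N : ℝ) + x) * Real.Gamma ((N : ℝ) + x) :=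
      Real.Gamma_add_one hpos.ne'
    push_cast
    rw [show (N : ℝ) + 1 + x = (N : ℝ) + x + 1 by ring, hG,
      Real.log_mul hpos.ne' (Real.Gamma_pos_of_pos hpos).ne']
    ring

/-- **Stirling's formula for `log Γ` on the positive real axis** with the tree's explicit error:
`|log Γ(w) − ((w − ½) log w − w + ½ log 2π)| ≤ (1/12)(1/w² + π/(2w))` (`w > 0`). [folklore] -/
theorem abs_log_Gamma_sub_le_real {w : ℝ} (hw : 0 < w) :
    |Real.log (Real.Gamma w) - ((w - 1 / 2) * Real.log w - w + Real.log (2 * π) / 2)| ≤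
      (1 / 12) * (1 / w ^ 2 + π / (2 * w)) := by
  have h := Literature.Analysis.SpecialFunctions.GammaStirling.abs_log_norm_Gamma_sub_le
    (w := (w : ℂ)) (by simpa using hw)
  have hn : ‖Complex.Gamma (w : ℂ)‖ = Real.Gamma w := by
    rw [Complex.Gamma_ofReal, Complex.norm_of_nonneg (Real.Gamma_pos_of_pos hw).le]
  have hn' : ‖(w : ℂ)‖ = w := Complex.norm_of_nonneg hw.le
  rw [hn, hn', Complex.arg_ofReal_of_nonneg hw.le, ofReal_re, ofReal_im] at h
  simpa using h

/-- The partial sums of the termwise derivatives in closed form: the limit value minus the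
Stirling error at `N + x`. [folklore] -/
theorem sum_range_termDeriv_eq {x : ℝ} (hx : 0 < x) (N : ℕ) :
    ∑ n ∈ Finset.range N, (((n : ℝ) + x + 1) * Real.log ((n : ℝ) + x + 1)
        - ((n : ℝ) + x) * Real.log ((n : ℝ) + x) - 1
        - (Real.log ((n : ℝ) + x) + Real.log ((n : ℝ) + x + 1)) / 2) =
      (Real.log (Real.Gamma x) - Real.log (2 * π) / 2 + x - x * Real.log x + Real.log x / 2)
        - (Real.log (Real.Gamma ((N : ℝ) + x)) - (((N : ℝ) + x - 1 / 2) * Real.log ((N : ℝ) + x)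
            - ((N : ℝ) + x) + Real.log (2 * π) / 2)) := by
  rw [sum_range_termDeriv, sum_range_log_eq_log_Gamma hx]
  ring

/-- **The limit of the partial sums**:
`∑_{n<N} dₙ → log Γ(x) − ½ log 2π + x − x log x + ½ log x`. [folklore] -/
theorem tendsto_sum_range_termDeriv {x : ℝ} (hx : 0 < x) :
    Tendsto (fun N : ℕ => ∑ n ∈ Finset.range N, (((n : ℝ) + x + 1) * Real.log ((n : ℝ) + x + 1)
        - ((n : ℝ) + x) * Real.log ((n : ℝ) + x) - 1
        - (Real.log ((n : ℝ) + x) + Real.log ((n : ℝ) + x + 1)) / 2)) atTop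
      (𝓝 (Real.log (Real.Gamma x) - Real.log (2 * π) / 2 + x - x * Real.log x
        + Real.log x / 2)) := by
  have hfun : (fun N : ℕ => ∑ n ∈ Finset.range N, (((n : ℝ) + x + 1) * Real.log ((n : ℝ) + x + 1)
        - ((n : ℝ) + x) * Real.log ((n : ℝ) + x) - 1
        - (Real.log ((n : ℝ) + x) + Real.log ((n : ℝ) + x + 1)) / 2)) =
      fun N : ℕ => (Real.log (Real.Gamma x) - Real.log (2 * π) / 2 + x - x * Real.log x
          + Real.log x / 2)
        - (Real.log (Real.Gamma ((N : ℝ) + x)) - (((N : ℝ) + x - 1 / 2) * Real.log ((N : ℝ) + x)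
            - ((N : ℝ) + x) + Real.log (2 * π) / 2)) :=
    funext fun N => sum_range_termDeriv_eq hx N
  rw [hfun]
  -- the Stirling error at `N + x` tends to `0`
  have hc : Tendsto (fun N : ℕ => (N : ℝ) + x) atTop atTop :=
    tendsto_natCast_atTop_atTop.atTop_add tendsto_const_nhds
  have h1 : Tendsto (fun N : ℕ => 1 / ((N : ℝ) + x) ^ 2) atTop (𝓝 0) := by
    simp_rw [one_div]
    exact ((tendsto_pow_atTop two_ne_zero).comp hc).inv_tendsto_atTop
  have h2 : Tendsto (fun N : ℕ => π / (2 * ((N : ℝ) + x))) atTop (𝓝 0) := by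
    have h := (hc.const_mul_atTop (two_pos : (0 : ℝ) < 2)).inv_tendsto_atTop.const_mul π
    simpa [div_eq_mul_inv] using h
  have hbound : Tendsto (fun N : ℕ => (1 / 12 : ℝ) * (1 / ((N : ℝ) + x) ^ 2
      + π / (2 * ((N : ℝ) + x)))) atTop (𝓝 0) := by
    simpa using (h1.add h2).const_mul (1 / 12 : ℝ)
  have he : Tendsto (fun N : ℕ => Real.log (Real.Gamma ((N : ℝ) + x))
      - (((N : ℝ) + x - 1 / 2) * Real.log ((N : ℝ) + x) - ((N : ℝ) + x)
        + Real.log (2 * π) / 2)) atTop (𝓝 0) := by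
    refine squeeze_zero_norm (fun N => ?_) hbound
    rw [Real.norm_eq_abs]
    exact abs_log_Gamma_sub_le_real (by positivity)
  have h := (tendsto_const_nhds (x := Real.log (Real.Gamma x) - Real.log (2 * π) / 2 + x
    - x * Real.log x + Real.log x / 2) (f := (atTop : Filter ℕ))).sub he
  rw [sub_zero] at h
  exact h

/-! ### Lerch's formula -/

/-- `∂/∂s R(s, x)|_{s=0} = log Γ(x) − ½ log 2π + x − x log x + ½ log x` for real `x > 0`.
[folklore] -/
theorem deriv_hurwitzR_zero {x : ℝ} (hx : 0 < x) :
    deriv (fun σ => hurwitzR σ x) 0 =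
      ((Real.log (Real.Gamma x) - Real.log (2 * π) / 2 + x - x * Real.log x
        + Real.log x / 2 : ℝ) : ℂ) := by
  have hb : 0 < ((x : ℂ)).re := by simpa using hx
  have hS := hasSum_deriv_hurwitzR hb (σ₀ := 0) zero_ne_one (by simp)
  simp_rw [deriv_hurwitzTrapTerm_zero_ofReal hx] at hS
  have h1 := hS.tendsto_sum_nat
  have h2 := (Complex.continuous_ofReal.tendsto _).comp (tendsto_sum_range_termDeriv hx)
  refine tendsto_nhds_unique h1 ?_
  convert h2 using 1
  funext N
  simp only [Function.comp_apply, ofReal_sum]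

/-- **Lerch's formula for the Euler–Maclaurin continuation, every real `x > 0`**: the function
`s ↦ x^{1−s}/(s−1) + x^{−s}/2 + R(s, x)` (`= ∑ₙ (n+x)^{−s}` for `Re s > 1`, `= hurwitzZetaC s x`
for `Re s > 0`) has derivative `log Γ(x) − ½ log(2π)` at `s = 0`. [folklore] -/
theorem hasDerivAt_hurwitzEM_zero {x : ℝ} (hx : 0 < x) :
    HasDerivAt (fun s : ℂ => (x : ℂ) ^ (1 - s) / (s - 1) + (x : ℂ) ^ (-s) / 2 + hurwitzR s x)
      (((Real.log (Real.Gamma x) - Real.log (2 * π) / 2 : ℝ)) : ℂ) 0 := by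
  have hb : 0 < ((x : ℂ)).re := by simpa using hx
  have hx0 : (x : ℂ) ≠ 0 := ofReal_ne_zero.mpr hx.ne'
  have hC : HasDerivAt (fun s : ℂ => (x : ℂ) ^ (1 - s)) (-((x : ℂ) * log x)) 0 := by
    have := ((hasDerivAt_id (0 : ℂ)).const_sub 1).const_cpow (c := (x : ℂ)) (Or.inl hx0)
    simpa using this
  have hQ : HasDerivAt (fun s : ℂ => (x : ℂ) ^ (1 - s) / (s - 1)) ((x : ℂ) * log x - x) 0 := by
    have h := hC.fun_div ((hasDerivAt_id' (0 : ℂ)).sub_const 1) (by norm_num : (0 : ℂ) - 1 ≠ 0)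
    refine h.congr_deriv ?_
    simp only [sub_zero, cpow_one]
    ring
  have hP : HasDerivAt (fun s : ℂ => (x : ℂ) ^ (-s) / 2) (-log x / 2) 0 := by
    have := (((hasDerivAt_id (0 : ℂ)).neg).const_cpow (c := (x : ℂ)) (Or.inl hx0)).div_const 2
    simpa using this
  have hR : HasDerivAt (fun s : ℂ => hurwitzR s x)
      ((Real.log (Real.Gamma x) - Real.log (2 * π) / 2 + x - x * Real.log x
        + Real.log x / 2 : ℝ) : ℂ) 0 := by
    rw [← deriv_hurwitzR_zero hx]
    exact (differentiableAt_hurwitzR hb zero_ne_one (by simp)).hasDerivAt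
  have h := (hQ.fun_add hP).fun_add hR
  refine h.congr_deriv ?_
  rw [← ofReal_log hx.le]
  push_cast
  ring

/-- **Lerch's formula.** For `0 < x ≤ 1`, the Hurwitz zeta function `s ↦ ζ(s, x)` has derivative
`log Γ(x) − ½ log(2π)` at `s = 0`. [folklore] (Lerch 1894; Whittaker–Watson §13.21; Berndt 1985.) -/
theorem hasDerivAt_hurwitzZeta_zero {x : ℝ} (hx0 : 0 < x) (hx1 : x ≤ 1) :
    HasDerivAt (hurwitzZeta (x : UnitAddCircle))
      (((Real.log (Real.Gamma x) - Real.log (2 * π) / 2 : ℝ)) : ℂ) 0 := by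
  refine (hasDerivAt_hurwitzEM_zero hx0).congr_of_eventuallyEq ?_
  have hopen : IsOpen {s : ℂ | -1 < s.re ∧ s ≠ 1} :=
    (isOpen_lt continuous_const Complex.continuous_re).inter isOpen_ne
  have hmem : (0 : ℂ) ∈ {s : ℂ | -1 < s.re ∧ s ≠ 1} := by simp
  filter_upwards [hopen.mem_nhds hmem] with s hs
  exact hurwitzZeta_eq_trapezoid hx0 hx1 hs.1 hs.2

/-- **Lerch's formula**, `deriv` form: `ζ'(0, x) = log Γ(x) − ½ log(2π)` for `0 < x ≤ 1`.
[folklore] -/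
theorem deriv_hurwitzZeta_zero {x : ℝ} (hx0 : 0 < x) (hx1 : x ≤ 1) :
    deriv (hurwitzZeta (x : UnitAddCircle)) 0 =
      (Real.log (Real.Gamma x) : ℂ) - (Real.log (2 * π) : ℂ) / 2 := by
  rw [(hasDerivAt_hurwitzZeta_zero hx0 hx1).deriv]
  push_cast
  ring

/-- **`ζ'(0) = −½ log(2π)`** as the case `x = 1` of Lerch's formula (`Γ(1) = 1`). Mathlib proves
the same value independently from the functional equation (`_root_.deriv_riemannZeta_zero`, stated
with `Complex.log (2π)`); this real-logarithm form is the one used below. [folklore] -/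
theorem deriv_riemannZeta_zero_ofReal : deriv riemannZeta 0 = -(Real.log (2 * π) : ℂ) / 2 := by
  have h := deriv_hurwitzZeta_zero (x := 1) one_pos le_rfl
  have h1 : ((1 : ℝ) : UnitAddCircle) = 0 := AddCircle.coe_period (1 : ℝ)
  rw [h1, hurwitzZeta_zero, Real.Gamma_one, Real.log_one] at h
  rw [h]
  push_cast
  ring

/-- **`ζ'(0) = −½ log(2π)`**, `HasDerivAt` form. [folklore] -/
theorem hasDerivAt_riemannZeta_zero :
    HasDerivAt riemannZeta (-(Real.log (2 * π) : ℂ) / 2) 0 := by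
  rw [← deriv_riemannZeta_zero_ofReal]
  exact (differentiableAt_riemannZeta one_ne_zero.symm).hasDerivAt


/-! ### The derivative of a Dirichlet `L`-function at `s = 0` -/

/-- Lerch's formula at the points `ZMod.toAddCircle j` entering Mathlib's `ZMod.LFunction`:
for `j ≠ 0` the parameter is `x_j = j.val/N ∈ (0, 1)`, and for `j = 0` it is `0 = 1 ∈ ℝ/ℤ`
(`ζ(s, 1) = ζ(s)`), where `log Γ(1) = 0`; Lean's `Real.log (Real.Gamma (0 / N)) = log 0 = 0`
records the same value, so one formula covers both cases. [folklore] -/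
theorem hasDerivAt_hurwitzZeta_toAddCircle_zero {N : ℕ} [NeZero N] (j : ZMod N) :
    HasDerivAt (hurwitzZeta (ZMod.toAddCircle j))
      (((Real.log (Real.Gamma (j.val / N)) - Real.log (2 * π) / 2 : ℝ)) : ℂ) 0 := by
  rcases eq_or_ne j 0 with rfl | hj
  · rw [map_zero, hurwitzZeta_zero, ZMod.val_zero, Nat.cast_zero, zero_div, Real.Gamma_zero,
      Real.log_zero, zero_sub]
    convert hasDerivAt_riemannZeta_zero using 1
    push_cast
    ring
  · have hv : 0 < j.val := Nat.pos_of_ne_zero fun h => hj ((ZMod.val_eq_zero j).mp h)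
    have h0 : 0 < (j.val : ℝ) / N := by
      have : (0 : ℝ) < N := Nat.cast_pos.mpr (NeZero.pos N)
      positivity
    have h1 : (j.val : ℝ) / N ≤ 1 :=
      (div_le_one (Nat.cast_pos.mpr (NeZero.pos N))).mpr (Nat.cast_le.mpr (ZMod.val_lt j).le)
    rw [ZMod.toAddCircle_apply]
    exact hasDerivAt_hurwitzZeta_zero h0 h1

/-- **The derivative at `s = 0` of a congruence `L`-function** `L(s, Φ) = N^{−s} ∑_j Φ(j) ζ(s, x_j)`:
`L'(0, Φ) = −(log N) L(0, Φ) + ∑_j Φ(j) (log Γ(x_j) − ½ log 2π)` (`x_j = j/N` for `0 < j < N`,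
`x_0 = 1`). [folklore] -/
theorem hasDerivAt_LFunction_zero {N : ℕ} [NeZero N] (Φ : ZMod N → ℂ) :
    HasDerivAt (ZMod.LFunction Φ)
      (-(Real.log N : ℂ) * ZMod.LFunction Φ 0 +
        ∑ j : ZMod N, Φ j *
          (((Real.log (Real.Gamma (j.val / N)) - Real.log (2 * π) / 2 : ℝ)) : ℂ)) 0 := by
  have hN : (N : ℂ) ≠ 0 := Nat.cast_ne_zero.mpr (NeZero.ne N)
  have hpow : HasDerivAt (fun s : ℂ => (N : ℂ) ^ (-s)) (-Complex.log N) 0 := by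
    simpa using ((hasDerivAt_id (0 : ℂ)).neg).const_cpow (c := (N : ℂ)) (Or.inl hN)
  have hsum : HasDerivAt (fun s : ℂ => ∑ j : ZMod N, Φ j * hurwitzZeta (ZMod.toAddCircle j) s)
      (∑ j : ZMod N, Φ j *
        (((Real.log (Real.Gamma (j.val / N)) - Real.log (2 * π) / 2 : ℝ)) : ℂ)) 0 :=
    HasDerivAt.fun_sum fun j _ => (hasDerivAt_hurwitzZeta_toAddCircle_zero j).const_mul (Φ j)
  have he : ZMod.LFunction Φ =
      fun s => (N : ℂ) ^ (-s) * ∑ j : ZMod N, Φ j * hurwitzZeta (ZMod.toAddCircle j) s := rfl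
  rw [he]
  refine (hpow.fun_mul hsum).congr_deriv ?_
  simp only [neg_zero, cpow_zero, one_mul]
  rw [← Complex.natCast_log]

/-- Reindexing a sum over `ZMod N` by the representatives `0, …, N − 1`. [folklore] -/
theorem sum_univ_zmod_eq_sum_range {N : ℕ} [NeZero N] (f : ZMod N → ℕ → ℂ) :
    ∑ j : ZMod N, f j j.val = ∑ a ∈ Finset.range N, f (a : ZMod N) a := by
  refine Finset.sum_nbij' (fun j : ZMod N => j.val) (fun a : ℕ => (a : ZMod N)) ?_ ?_ ?_ ?_ ?_
  · intro j _
    exact Finset.mem_range.mpr (ZMod.val_lt j)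
  · intro a _
    exact Finset.mem_univ _
  · intro j _
    exact ZMod.natCast_zmod_val j
  · intro a ha
    exact ZMod.val_natCast_of_lt (Finset.mem_range.mp ha)
  · intro j _
    rw [ZMod.natCast_zmod_val]

/-- **`L'(0, χ)` for a non-trivial Dirichlet character** `χ` mod `N`:
`L'(0, χ) = −(log N) L(0, χ) + ∑_{a=1}^{N−1} χ(a) log Γ(a/N)` (the constant `−½ log 2π` drops out
because `∑ χ = 0`; the `a = 0` term of the `Finset.range` sum vanishes). With the tree's
`L(0, χ) = −B_{1,χ}` (`DirichletLAtZero.lean`) this is the classical formula behind the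
Chowla–Selberg formula and Stark's conjectures at `s = 0`. [folklore] -/
theorem deriv_LFunction_zero_of_ne_one {N : ℕ} [NeZero N] {χ : DirichletCharacter ℂ N}
    (hχ : χ ≠ 1) :
    deriv χ.LFunction 0 = -(Real.log N : ℂ) * χ.LFunction 0 +
      ∑ a ∈ Finset.range N, χ a * (Real.log (Real.Gamma (a / N)) : ℂ) := by
  have h := (hasDerivAt_LFunction_zero (N := N) (fun j => χ j)).deriv
  have he : χ.LFunction = ZMod.LFunction (fun j => χ j) := rfl
  rw [he, h]
  have hs : ∑ j : ZMod N, (χ j : ℂ) = 0 := χ.sum_eq_zero_of_ne_one hχ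
  have hsplit : ∑ j : ZMod N, χ j *
      (((Real.log (Real.Gamma (j.val / N)) - Real.log (2 * π) / 2 : ℝ)) : ℂ) =
      ∑ j : ZMod N, χ j * (Real.log (Real.Gamma (j.val / N)) : ℂ)
        - (∑ j : ZMod N, χ j) * (Real.log (2 * π) / 2 : ℂ) := by
    rw [Finset.sum_mul, ← Finset.sum_sub_distrib]
    refine Finset.sum_congr rfl fun j _ => ?_
    push_cast
    ring
  rw [hsplit, hs, zero_mul, sub_zero,
    sum_univ_zmod_eq_sum_range (fun j a => χ j * (Real.log (Real.Gamma (a / N)) : ℂ))]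

end Lerch

end Literature.NumberTheory.LFunctions

end
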